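import Mathlib.Analysis.Calculus.ContDiff.RCLike
import Literature.Geometry.Lorentzian.CausalFutureProofs
import Literature.Geometry.Lorentzian.CausalityChronologyProofs
import Literature.Geometry.Lorentzian.CausalityClosure
import Literature.Geometry.Lorentzian.CausalityClosedProofs
import HarnessLib

/-!
# Push-up `I⁺(J⁺ S) = I⁺ S` and `J⁺ S ⊆ closure (I⁺ S)` on manifolds without boundary

This file proves, for a time-oriented `Cⁿ` (`n ≥ 1`) Lorentzian metric on a finite-dimensional
manifold **without boundary**, O'Neill's Lemma 14.6 (2) for points and the push-up Corollary 14.1: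

* `LorentzianMetric.mem_closure_chronologicalFuture_of_isFutureCausalCurveOn`: if `γ` is a future
  causal curve on `[a, b]` then `γ b ∈ closure (I⁺(γ a))`;
* `LorentzianMetric.causalFuture_subset_closure_chronologicalFuture_of_boundaryless`:
  `J⁺(S) ⊆ closure (I⁺(S))` (O'Neill 1983, Ch. 14, Lemma 14.6 (2)), and the restricted discharge
  `causalFuture_subset_closure_chronologicalFuture_holds_of_boundaryless` of the parametrised
  predicate `LorentzianMetric.causalFuture_subset_closure_chronologicalFuture` of
  `Literature.Geometry.Lorentzian.Causality`;
* `LorentzianMetric.mem_chronologicalFuture_of_mem_causalFuture` (**push-up**, O'Neill 1983,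
  Ch. 14, Cor. 14.1: `p ≤ q ≪ r ⟹ p ≪ r`), `chronologicalFuture_causalFuture_eq_of_boundaryless`
  (`I⁺(J⁺ S) = I⁺ S`) and the restricted discharge
  `chronologicalFuture_causalFuture_holds_of_boundaryless : g.chronologicalFuture_causalFuture τ`
  of the parametrised predicate `LorentzianMetric.chronologicalFuture_causalFuture` (which is false
  on manifolds *with* boundary, `Literature.Geometry.Lorentzian.CausalityBoundary`).

As a consequence the conditional form of Lemma 14.6 (2) in
`Literature.Geometry.Lorentzian.CausalityClosure`
(`causalFuture_subset_closure_chronologicalFuture_of_chronologicalFuture_causalFuture`) becomes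
unconditional on manifolds without boundary.

## The proof ("tilting" a causal curve; differs from the printed one)

O'Neill derives Cor. 14.1 from Prop. 10.46 (a fixed-endpoint variation of a causal curve that is
not a null pregeodesic through timelike curves). The causal curves of
`Literature.Geometry.Lorentzian.Causality` are merely differentiable (`IsFutureCausalCurveOn`:
velocity defined at every parameter but neither continuous nor locally bounded), for which the
variational calculus is not available. Instead we prove directly the *local* statement
(`exists_nhds_tilt`): every point `p` has a neighbourhood `N` such that for every future causal
curve `γ : [a, b] → N` and every neighbourhood `V` of `γ b` there is a future **timelike** curve
from `γ a` to a point of `V`. In the extended chart `φ` at `p`, with `G` the coordinate metric,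
`T₀` the coordinate image of the orienting vector at `p` and the covector `ℓ = -G_{x₀}(T₀, ·)`
(positive on future causal vectors, uniformly: `ℓ(v) ≥ c‖v‖` near `x₀`, `PushUp.exists_cone_const`,
by compactness of the unit sphere), the tilted curve is
`C(s) = φ(γ s) + κ ℓ(φ(γ s) - φ(γ a)) • T₀`, with velocity `v + κ ℓ(v) T₀`, `v = (φ ∘ γ)'(s)`.
At the base point of `v` one has `G(v + κℓT₀, v + κℓT₀) ≤ -κ ℓ(v)²` (`PushUp.tilt_neg`), a margin
*proportional to `κ`*, while moving the base point by the displacement `κ ℓ(…) T₀ = O(κ)` costs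
`O(κ) ‖v‖²` by the Lipschitz continuity of the `C¹` coordinate metric — so `κ` cancels and every
small `κ > 0` gives a timelike curve, whose endpoint `φ⁻¹(φ(γ b) + κ ℓ(…) T₀)` tends to `γ b` as
`κ → 0`. The global statements follow by a continuous induction along `[a, b]` using the openness
of `I⁻` (`isOpen_chronologicalPast_of_boundaryless`) and the transitivity of `≪`
(`mem_chronologicalFuture_trans`, corner smoothing). No definitions and no named facts are
introduced.

## References

* B. O'Neill, *Semi-Riemannian geometry with applications to relativity*, Academic Press 1983,
  Ch. 14, Cor. 14.1 (p. 402), p. 403 (`I⁺(A) = I⁺(J⁺A)`), Lemma 14.6 (2) (p. 404); Ch. 10,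
  Prop. 10.46; Ch. 5, Lemma 5.29 ff. (timecones). Key `ONeillSemiRiemannian1983`.
* R. Penrose, *Techniques of differential topology in relativity*, SIAM 1972, Prop. 2.18, 2.19.
-/

noncomputable section

open Bundle Set Filter Function
open scoped Manifold ContDiff Topology NNReal

namespace Literature.Geometry.Lorentzian

/-! ### Part I: the tilt estimate in a normed space -/

namespace PushUp

variable {F : Type*} [NormedAddCommGroup F] [NormedSpace ℝ F]

/-- Difference of two bilinear forms evaluated on a pair of vectors is bounded by the operator norm
of the difference. [folklore] -/
theorem bilin_sub_le (G G' : F →L[ℝ] F →L[ℝ] ℝ) (u w : F) :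
    G' u w - G u w ≤ ‖G' - G‖ * ‖u‖ * ‖w‖ := by
  have h : (G' - G) u w = G' u w - G u w := by
    simp only [sub_apply]
  have h2 : ‖(G' - G) u w‖ ≤ ‖G' - G‖ * ‖u‖ * ‖w‖ := (G' - G).le_opNorm₂ u w
  rw [h, Real.norm_eq_abs] at h2
  linarith [le_abs_self (G' u w - G u w)]

/-- Companion of `bilin_sub_le` with the difference taken the other way. [folklore] -/
theorem bilin_sub_le' (G G' : F →L[ℝ] F →L[ℝ] ℝ) (u w : F) :
    G u w - G' u w ≤ ‖G' - G‖ * ‖u‖ * ‖w‖ := by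
  have h : (G' - G) u w = G' u w - G u w := by
    simp only [sub_apply]
  have h2 : ‖(G' - G) u w‖ ≤ ‖G' - G‖ * ‖u‖ * ‖w‖ := (G' - G).le_opNorm₂ u w
  rw [h, Real.norm_eq_abs] at h2
  linarith [neg_abs_le (G' u w - G u w)]

/-- **The tilt estimate.** Let `G` be a symmetric bilinear form (the metric at the base point of
`v`), `v` a vector with `G(v,v) ≤ 0` ("causal"), `T₀` a vector with `G(T₀,T₀) ≤ 0`, and
`ℓ ≥ c‖v‖ > 0` a number with `G(v, T₀) ≤ -ℓ + (c/2)‖v‖` (so `G(v,T₀) ≤ -ℓ/2`). Then for the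
tilted vector `V = v + κℓ T₀`, `0 < κ ≤ 1`, and every bilinear form `G'` with
`‖G' - G‖ ≤ κ d`, `d (1/c + ‖T₀‖)² ≤ 1/2`, one has `G'(V, V) ≤ -κℓ²/2`: the gain `-κℓ²` at `G`
beats the perturbation, *uniformly in `κ`*. This elementary inequality replaces the variational
argument of O'Neill 1983, Ch. 10, Prop. 10.46 in the proof of Cor. 14.1. [folklore] -/
theorem tilt_neg {G G' : F →L[ℝ] F →L[ℝ] ℝ} {v T₀ : F} {κ ℓ c d : ℝ}
    (hκ : 0 < κ) (hκ1 : κ ≤ 1) (hc : 0 < c) (hℓ : c * ‖v‖ ≤ ℓ) (hℓ0 : 0 < ℓ)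
    (hsymm : G T₀ v = G v T₀)
    (hvv : G v v ≤ 0) (hvT : G v T₀ ≤ -ℓ + c / 2 * ‖v‖) (hTT : G T₀ T₀ ≤ 0)
    (hGG : ‖G' - G‖ ≤ κ * d) (hd0 : 0 ≤ d) (hd : d * (1 / c + ‖T₀‖) ^ 2 ≤ 1 / 2) :
    G' (v + (κ * ℓ) • T₀) (v + (κ * ℓ) • T₀) ≤ -(κ * ℓ ^ 2) / 2 := by
  set V := v + (κ * ℓ) • T₀ with hV
  -- expansion of `G V V`
  have hexp : G V V = G v v + 2 * (κ * ℓ) * G v T₀ + (κ * ℓ) ^ 2 * G T₀ T₀ := by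
    simp only [hV, map_add, map_smul, add_apply, smul_apply, smul_eq_mul, hsymm]
    ring
  have hkl : 0 < κ * ℓ := mul_pos hκ hℓ0
  have hvnorm : ‖v‖ ≤ ℓ / c := by
    rw [le_div_iff₀ hc]; linarith [mul_comm c ‖v‖]
  have h1 : G V V ≤ -(κ * ℓ ^ 2) := by
    rw [hexp]
    have h2 : 2 * (κ * ℓ) * G v T₀ ≤ 2 * (κ * ℓ) * (-ℓ + c / 2 * ‖v‖) :=
      mul_le_mul_of_nonneg_left hvT (by positivity)
    have h3 : (κ * ℓ) ^ 2 * G T₀ T₀ ≤ 0 := mul_nonpos_iff.mpr (Or.inl ⟨sq_nonneg _, hTT⟩)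
    have h4 : c / 2 * ‖v‖ ≤ ℓ / 2 := by nlinarith
    nlinarith
  -- the norm of `V`
  have hVn : ‖V‖ ≤ ℓ * (1 / c + ‖T₀‖) := by
    calc ‖V‖ ≤ ‖v‖ + ‖(κ * ℓ) • T₀‖ := norm_add_le _ _
      _ = ‖v‖ + κ * ℓ * ‖T₀‖ := by rw [norm_smul, Real.norm_of_nonneg hkl.le]
      _ ≤ ℓ / c + 1 * ℓ * ‖T₀‖ :=
          add_le_add hvnorm (mul_le_mul_of_nonneg_right
            (mul_le_mul_of_nonneg_right hκ1 hℓ0.le) (norm_nonneg _))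
      _ = ℓ * (1 / c + ‖T₀‖) := by ring
  have hVn0 : 0 ≤ ℓ * (1 / c + ‖T₀‖) := by positivity
  have hκd : 0 ≤ κ * d := mul_nonneg hκ.le hd0
  have h5 : G' V V - G V V ≤ κ * ℓ ^ 2 / 2 := by
    calc G' V V - G V V ≤ ‖G' - G‖ * ‖V‖ * ‖V‖ := bilin_sub_le G G' V V
      _ ≤ (κ * d) * (ℓ * (1 / c + ‖T₀‖)) * (ℓ * (1 / c + ‖T₀‖)) :=
          mul_le_mul (mul_le_mul hGG hVn (norm_nonneg _) hκd) hVn (norm_nonneg _)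
            (mul_nonneg hκd hVn0)
      _ = κ * ℓ ^ 2 * (d * (1 / c + ‖T₀‖) ^ 2) := by ring
      _ ≤ κ * ℓ ^ 2 * (1 / 2) :=
          mul_le_mul_of_nonneg_left hd (mul_nonneg hκ.le (sq_nonneg ℓ))
      _ = κ * ℓ ^ 2 / 2 := by ring
  linarith

/-- **Time orientation of the tilted vector**: with notation as in `tilt_neg`, if at the new base
point `G'(T₀, v) ≤ -ℓ + (c/2)‖v‖` and `G'(T₀, T₀) ≤ 0`, then `G'(T₀, v + κℓT₀) < 0`, i.e. the
tilted vector lies in the timecone of `T₀`. O'Neill 1983, Ch. 5, Lemma 5.29 (timecones).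
[folklore] -/
theorem tilt_orient {G' : F →L[ℝ] F →L[ℝ] ℝ} {v T₀ : F} {κ ℓ c : ℝ} (hκ : 0 < κ)
    (hℓ : c * ‖v‖ ≤ ℓ) (hℓ0 : 0 < ℓ) (hvT : G' T₀ v ≤ -ℓ + c / 2 * ‖v‖) (hTT : G' T₀ T₀ ≤ 0) :
    G' T₀ (v + (κ * ℓ) • T₀) < 0 := by
  have h : G' T₀ (v + (κ * ℓ) • T₀) = G' T₀ v + κ * ℓ * G' T₀ T₀ := by
    simp only [map_add, map_smul, smul_eq_mul]
  rw [h]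
  have h1 : κ * ℓ * G' T₀ T₀ ≤ 0 := mul_nonpos_iff.mpr (Or.inl ⟨by positivity, hTT⟩)
  have h2 : c / 2 * ‖v‖ ≤ ℓ / 2 := by nlinarith [norm_nonneg v]
  linarith

/-- **Uniform cone constant.** In a finite-dimensional normed space let `G₀` be a bilinear form and
`T₀` a vector such that `G₀(T₀, v) < 0` for every `v ≠ 0` with `G₀(v, v) ≤ 0` and `G₀(T₀, v) ≤ 0`
(a timelike `T₀` is never orthogonal to a causal vector). Then there are `c, m > 0` such that for
every bilinear form `G` and covector `t` within `m` of `G₀`, `G₀(T₀, ·)`, every `v` with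
`G(v, v) ≤ 0` and `t(v) < 0` (future causal for the perturbed data) satisfies `c‖v‖ ≤ -G₀(T₀, v)`.
Proof: minimise `-G₀(T₀, ·)` and `max (G₀(v,v)) (G₀(T₀,v))` over compact pieces of the unit sphere.
O'Neill 1983, Ch. 5, Lemma 5.26 ff. (p. 141) for the pointwise statement. [folklore] -/
theorem exists_cone_const [FiniteDimensional ℝ F] (G₀ : F →L[ℝ] F →L[ℝ] ℝ) (T₀ : F)
    (hpos : ∀ v, v ≠ 0 → G₀ v v ≤ 0 → G₀ T₀ v ≤ 0 → G₀ T₀ v < 0) :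
    ∃ c > 0, ∃ m > 0, ∀ (G : F →L[ℝ] F →L[ℝ] ℝ) (t : F →L[ℝ] ℝ), ‖G - G₀‖ < m →
      ‖t - G₀ T₀‖ < m → ∀ v, G v v ≤ 0 → t v < 0 → c * ‖v‖ ≤ -(G₀ T₀ v) := by
  have hS : IsCompact (Metric.sphere (0 : F) 1) := isCompact_sphere 0 1
  have hq : Continuous fun u : F ↦ G₀ u u :=
    G₀.continuous₂.comp (continuous_id.prodMk continuous_id)
  have hl : Continuous fun u : F ↦ G₀ T₀ u := (G₀ T₀).continuous
  -- Step 1: `-G₀ T₀ u ≥ 2c` on the causal unit vectors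
  obtain ⟨c, hc, hc'⟩ : ∃ c > 0, ∀ u ∈ Metric.sphere (0 : F) 1, G₀ u u ≤ 0 → G₀ T₀ u ≤ 0 →
      2 * c ≤ -(G₀ T₀ u) := by
    set S₁ : Set F := Metric.sphere (0 : F) 1 ∩ {u | G₀ u u ≤ 0 ∧ G₀ T₀ u ≤ 0} with hS₁
    have hS₁c : IsCompact S₁ := hS.inter_right
      ((isClosed_le hq continuous_const).inter (isClosed_le hl continuous_const))
    rcases S₁.eq_empty_or_nonempty with h | h
    · refine ⟨1, one_pos, fun u hu h1 h2 ↦ ?_⟩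
      have : u ∈ S₁ := ⟨hu, h1, h2⟩
      rw [h] at this
      exact this.elim
    · obtain ⟨u₀, hu₀, hmin⟩ :=
        hS₁c.exists_isMinOn h (f := fun u ↦ -(G₀ T₀ u)) hl.neg.continuousOn
      have hu₀1 : ‖u₀‖ = 1 := mem_sphere_zero_iff_norm.mp hu₀.1
      have hu₀0 : u₀ ≠ 0 := by
        rintro rfl; simp at hu₀1
      have hf0 : 0 < -(G₀ T₀ u₀) := by
        have := hpos u₀ hu₀0 hu₀.2.1 hu₀.2.2; linarith
      refine ⟨-(G₀ T₀ u₀) / 2, by positivity, fun u hu h1 h2 ↦ ?_⟩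
      have := hmin (show u ∈ S₁ from ⟨hu, h1, h2⟩)
      simp only [mem_setOf_eq] at this
      linarith
  -- Step 2: away from those, `max (G₀ u u) (G₀ T₀ u) ≥ 2m`
  obtain ⟨m, hm, hm'⟩ : ∃ m > 0, ∀ u ∈ Metric.sphere (0 : F) 1, -(G₀ T₀ u) ≤ c →
      2 * m ≤ max (G₀ u u) (G₀ T₀ u) := by
    set S₂ : Set F := Metric.sphere (0 : F) 1 ∩ {u | -(G₀ T₀ u) ≤ c} with hS₂
    have hS₂c : IsCompact S₂ := hS.inter_right (isClosed_le hl.neg continuous_const)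
    rcases S₂.eq_empty_or_nonempty with h | h
    · refine ⟨1, one_pos, fun u hu h1 ↦ ?_⟩
      have : u ∈ S₂ := ⟨hu, h1⟩
      rw [h] at this
      exact this.elim
    · obtain ⟨u₁, hu₁, hmin⟩ :=
        hS₂c.exists_isMinOn h (f := fun u ↦ max (G₀ u u) (G₀ T₀ u)) (hq.max hl).continuousOn
      have hΦ : 0 < max (G₀ u₁ u₁) (G₀ T₀ u₁) := by
        by_contra hle
        have hle := not_lt.mp hle
        have h1 : G₀ u₁ u₁ ≤ 0 := (le_max_left _ _).trans hle
        have h2 : G₀ T₀ u₁ ≤ 0 := (le_max_right _ _).trans hle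
        have h3 := hc' u₁ hu₁.1 h1 h2
        have h4 : -(G₀ T₀ u₁) ≤ c := hu₁.2
        linarith
      refine ⟨max (G₀ u₁ u₁) (G₀ T₀ u₁) / 2, by positivity, fun u hu h1 ↦ ?_⟩
      have := hmin (show u ∈ S₂ from ⟨hu, h1⟩)
      simp only [mem_setOf_eq] at this
      linarith
  refine ⟨c, hc, m, hm, fun G t hG ht v hvv htv ↦ ?_⟩
  -- normalise `v`
  have hv0 : v ≠ 0 := by
    rintro rfl
    rw [map_zero] at htv
    exact lt_irrefl 0 htv
  set r : ℝ := ‖v‖ with hr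
  have hr0 : 0 < r := norm_pos_iff.mpr hv0
  set u : F := r⁻¹ • v with hu
  have hu1 : u ∈ Metric.sphere (0 : F) 1 := by
    rw [mem_sphere_zero_iff_norm, hu, norm_smul, norm_inv, Real.norm_of_nonneg hr0.le,
      inv_mul_cancel₀ hr0.ne']
  have hun : ‖u‖ = 1 := mem_sphere_zero_iff_norm.mp hu1
  have hri : 0 ≤ r⁻¹ := inv_nonneg.mpr hr0.le
  have hGuu : G u u = r⁻¹ * (r⁻¹ * G v v) := by
    simp only [hu, map_smul, smul_apply, smul_eq_mul]
  have hGuu' : G u u ≤ 0 := by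
    rw [hGuu]
    exact mul_nonpos_iff.mpr (Or.inl ⟨hri, mul_nonpos_iff.mpr (Or.inl ⟨hri, hvv⟩)⟩)
  have htu : t u < 0 := by
    have : t u = r⁻¹ * t v := by simp only [hu, map_smul, smul_eq_mul]
    rw [this]
    exact mul_neg_of_pos_of_neg (inv_pos.mpr hr0) htv
  -- compare with `G₀`
  have h1 : G₀ u u < m := by
    have h2 : G₀ u u - G u u ≤ ‖G - G₀‖ * ‖u‖ * ‖u‖ := bilin_sub_le' G₀ G u u
    rw [hun, mul_one, mul_one] at h2
    linarith
  have h2 : G₀ T₀ u < m := by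
    have h3 : ‖(t - G₀ T₀) u‖ ≤ ‖t - G₀ T₀‖ * ‖u‖ := (t - G₀ T₀).le_opNorm u
    have h4 : (t - G₀ T₀) u = t u - G₀ T₀ u := by simp only [sub_apply]
    rw [hun, mul_one, h4, Real.norm_eq_abs] at h3
    linarith [neg_abs_le (t u - G₀ T₀ u)]
  have h3 : c < -(G₀ T₀ u) := by
    by_contra hle
    have hle := not_lt.mp hle
    have := hm' u hu1 hle
    have h4 : max (G₀ u u) (G₀ T₀ u) < m := max_lt h1 h2
    linarith
  -- scale back
  have h4 : -(G₀ T₀ u) = r⁻¹ * (-(G₀ T₀ v)) := by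
    simp only [hu, map_smul, smul_eq_mul]; ring
  rw [h4] at h3
  have h5 : c * r < -(G₀ T₀ v) := by
    have := mul_lt_mul_of_pos_right h3 hr0
    rwa [mul_comm (r⁻¹) _, mul_assoc, inv_mul_cancel₀ hr0.ne', mul_one] at this
  exact h5.le

end PushUp

/-! ### Part II: the local tilt lemma on the manifold -/

variable {E : Type*} [NormedAddCommGroup E] [NormedSpace ℝ E] {H : Type*} [TopologicalSpace H]
  {I : ModelWithCorners ℝ E H} {n : ℕ∞ω} {M : Type*} [TopologicalSpace M] [ChartedSpace H M]
  [IsManifold I ∞ M]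

section CoordLemmas

variable {g : LorentzianMetric I n M} {τ : TimeOrientation g} {p : M}

/-- **Causality in coordinates**: `ψ_y v` is causal at `y = φ⁻¹ x` iff `Ĝ_x(v,v) ≤ 0` and `v ≠ 0`.
[folklore] -/
lemma isCausal_symmL_iff {x : E} (hx : x ∈ (extChartAt I p).target) (v : E) :
    g.IsCausal ((trivializationAt E (TangentSpace I) p).symmL ℝ ((extChartAt I p).symm x) v) ↔
      g.coordMetric p x v v ≤ 0 ∧ v ≠ 0 := by
  have hy : (extChartAt I p).symm x ∈ (trivializationAt E (TangentSpace I) p).baseSet := by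
    simp only [TangentBundle.trivializationAt_baseSet, ← extChartAt_source I p]
    exact (extChartAt I p).map_target hx
  rw [LorentzianMetric.isCausal_iff, g.coordMetric_apply hx]
  have hne : (trivializationAt E (TangentSpace I) p).symmL ℝ ((extChartAt I p).symm x) v ≠ 0 ↔
      v ≠ 0 := by
    refine not_congr ⟨fun h ↦ ?_, fun h ↦ by rw [h, map_zero]⟩
    have := congrArg
      ((trivializationAt E (TangentSpace I) p).continuousLinearMapAt ℝ ((extChartAt I p).symm x)) h
    rwa [(trivializationAt E (TangentSpace I) p).continuousLinearMapAt_symmL hy, map_zero] at this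
  rw [hne]

/-- **A good coordinate curve is a timelike curve.** If `c : ℝ → E` is differentiable at every
parameter of `[s₀, s₁]` with velocity `u s`, stays in an open subset `U` of the chart target, and
`(c s, u s)` satisfies the coordinate conditions of future-directed timelikeness, then `φ⁻¹ ∘ c` is
a future-directed timelike curve on `[s₀, s₁]`. [folklore] -/
theorem isFutureTimelikeCurveOn_extChartAt_symm_comp {U : Set E} (hU : IsOpen U)
    (hUt : U ⊆ (extChartAt I p).target) {c u : ℝ → E} {s₀ s₁ : ℝ}
    (h : ∀ s ∈ Icc s₀ s₁, HasDerivAt c (u s) s ∧ c s ∈ U ∧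
      g.coordMetric p (c s) (u s) (u s) < 0 ∧
      g.coordMetric p (c s) (τ.coordTime p (c s)) (u s) < 0) :
    g.IsFutureTimelikeCurveOn τ ((extChartAt I p).symm ∘ c) (Icc s₀ s₁) := by
  intro s hs
  obtain ⟨hd, hcU, ht, hf⟩ := h s hs
  have hmem : ∀ᶠ s' in 𝓝 s, c s' ∈ (extChartAt I p).target :=
    (hd.continuousAt.eventually (hU.mem_nhds hcU)).mono fun s' hs' ↦ hUt hs'
  obtain ⟨hmd, hvel⟩ := hasMFDerivAt_extChartAt_symm_comp (p := p) hd hmem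
  have hu0 : u s ≠ 0 := by
    intro h0
    have : g.coordMetric p (c s) (u s) (u s) = 0 := by rw [h0]; simp
    linarith
  refine ⟨hmd, ?_, ?_⟩
  · rw [hvel]; exact (isTimelike_symmL_iff (hUt hcU) (u s)).mpr ht
  · rw [hvel]; exact (isFutureDirected_symmL_iff (hUt hcU) (u s)).mpr ⟨⟨ht.le, hu0⟩, hf⟩

end CoordLemmas

namespace LorentzianMetric

variable {g : LorentzianMetric I n M} {τ : TimeOrientation g}

/-- **The local tilt lemma.** On a manifold without boundary, of finite dimension, with a `Cⁿ`
(`n ≥ 1`) time-oriented Lorentzian metric, every point `p` has a neighbourhood `N` such that: for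
every future causal curve `γ` on `[a, b]`, `a < b`, with values in `N`, and every neighbourhood `V`
of `γ b`, there is a future *timelike* curve on `[a, b]` from `γ a` to a point of `V` — the curve
`φ⁻¹(φ(γ s) + κ ℓ(φ(γ s) - φ(γ a)) T₀)` for small `κ > 0` (see the module docstring). This is the
local form of O'Neill 1983, Ch. 14, Cor. 14.1 / Lemma 14.6 (2), proved here without Prop. 10.46.
[cite: ONeillSemiRiemannian1983, Ch. 14, Cor. 14.1 (p. 402) and Lemma 14.6 (2) (p. 404)] -/
theorem exists_nhds_tilt [BoundarylessManifold I M] [FiniteDimensional ℝ E] (hn : 1 ≤ n) (p : M) :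
    ∃ N ∈ 𝓝 p, ∀ (γ : ℝ → M) (a b : ℝ), a < b → g.IsFutureCausalCurveOn τ γ (Icc a b) →
      (∀ s ∈ Icc a b, γ s ∈ N) → ∀ V ∈ 𝓝 (γ b), ∃ y ∈ V, ∃ β : ℝ → M,
        g.IsFutureTimelikeCurveOn τ β (Icc a b) ∧ β a = γ a ∧ β b = y := by
  -- the chart at `p`
  set x₀ : E := extChartAt I p p with hx₀def
  have hps : p ∈ (chartAt H p).source := mem_chart_source H p
  have hx₀t : x₀ ∈ (extChartAt I p).target :=
    (extChartAt I p).map_source (mem_extChartAt_source p)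
  have hx₀p : (extChartAt I p).symm x₀ = p := (extChartAt I p).left_inv (mem_extChartAt_source p)
  have htarget : (extChartAt I p).target ∈ 𝓝 x₀ := by
    have hint : x₀ ∈ interior (extChartAt I p).target :=
      ModelWithCorners.isInteriorPoint_iff.mp (BoundarylessManifold.isInteriorPoint (I := I))
    exact mem_interior_iff_mem_nhds.mp hint
  -- the metric and the time orientation in coordinates
  set T₀ : E := τ.coordTime p x₀ with hT₀def
  set ℓL : E →L[ℝ] ℝ := -(g.coordMetric p x₀ T₀) with hℓLdef
  have hℓL : ∀ w, ℓL w = -(g.coordMetric p x₀ T₀ w) := fun w ↦ by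
    simp only [hℓLdef, neg_apply]
  have hGcd : ContDiffOn ℝ 1 (g.coordMetric p) (extChartAt I p).target :=
    g.contDiffOn_coordMetric hn p
  have hGc : ContinuousAt (g.coordMetric p) x₀ := (hGcd.continuousOn x₀ hx₀t).continuousAt htarget
  have hGTc : ContinuousAt (fun x ↦ g.coordMetric p x (τ.coordTime p x)) x₀ :=
    ((hGcd.continuousOn.clm_apply (τ.continuousOn_coordTime hn p)) x₀ hx₀t).continuousAt htarget
  -- `T₀` is the coordinate image of `T_p`, future timelike at the centre
  have hyb : (extChartAt I p).symm x₀ ∈ (trivializationAt E (TangentSpace I) p).baseSet := by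
    rw [hx₀p]; simp
  have hsymmT₀ : (trivializationAt E (TangentSpace I) p).symmL ℝ ((extChartAt I p).symm x₀) T₀ =
      τ.vectorField ((extChartAt I p).symm x₀) := by
    rw [hT₀def, τ.coordTime_apply hx₀t, Trivialization.symmL_continuousLinearMapAt _ hyb]
  have hT₀T₀ : g.coordMetric p x₀ T₀ T₀ < 0 := by
    rw [g.coordMetric_apply hx₀t T₀ T₀, hsymmT₀]
    exact τ.isTimelike _
  have hT₀0 : T₀ ≠ 0 := by
    intro h0
    have : g.coordMetric p x₀ T₀ T₀ = 0 := by rw [h0]; simp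
    linarith
  -- a timelike vector is never orthogonal to a causal one
  have hpos : ∀ v : E, v ≠ 0 → g.coordMetric p x₀ v v ≤ 0 → g.coordMetric p x₀ T₀ v ≤ 0 →
      g.coordMetric p x₀ T₀ v < 0 := by
    intro v hv0 hvv hTv
    refine lt_of_le_of_ne hTv fun h0 ↦ ?_
    have hc : g.IsCausal
        ((trivializationAt E (TangentSpace I) p).symmL ℝ ((extChartAt I p).symm x₀) v) :=
      (isCausal_symmL_iff hx₀t v).mpr ⟨hvv, hv0⟩
    refine g.val_ne_zero_of_isTimelike_of_isCausal (τ.isTimelike ((extChartAt I p).symm x₀)) hc ?_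
    rw [← hsymmT₀, ← g.coordMetric_apply hx₀t]
    exact h0
  -- the cone constant `c` and the closeness `m`
  obtain ⟨c, hc, m, hm, hcone⟩ := PushUp.exists_cone_const (g.coordMetric p x₀) T₀ hpos
  -- radius `δ₁`: target, signs of `G T₀ T₀` and `G (Tc) T₀`
  obtain ⟨δ₁, hδ₁, hδ₁'⟩ : ∃ δ > 0, ∀ z : E, ‖z - x₀‖ < δ → z ∈ (extChartAt I p).target ∧
      g.coordMetric p z T₀ T₀ < 0 ∧ g.coordMetric p z (τ.coordTime p z) T₀ < 0 := by
    have h1 : ∀ᶠ z in 𝓝 x₀, z ∈ (extChartAt I p).target := htarget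
    have h4 : ∀ᶠ z in 𝓝 x₀, g.coordMetric p z T₀ T₀ < 0 := by
      have hcts : ContinuousAt (fun z ↦ g.coordMetric p z T₀ T₀) x₀ :=
        (hGc.clm_apply continuousAt_const).clm_apply continuousAt_const
      exact hcts.preimage_mem_nhds (Iio_mem_nhds hT₀T₀)
    have h5 : ∀ᶠ z in 𝓝 x₀, g.coordMetric p z (τ.coordTime p z) T₀ < 0 := by
      have hcts : ContinuousAt (fun z ↦ g.coordMetric p z (τ.coordTime p z) T₀) x₀ :=
        hGTc.clm_apply continuousAt_const
      exact hcts.preimage_mem_nhds (Iio_mem_nhds hT₀T₀)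
    obtain ⟨δ, hδ, h⟩ := Metric.eventually_nhds_iff.mp (h1.and (h4.and h5))
    exact ⟨δ, hδ, fun z hz ↦ h (by rwa [dist_eq_norm])⟩
  -- radii `δ₂`, `δ₃`: closeness of `G` and of the covector `G(Tc, ·)` to their values at `x₀`
  have hm₁ : 0 < min m (c / (2 * (‖T₀‖ + 1))) := lt_min hm (by positivity)
  obtain ⟨δ₂, hδ₂, hδ₂'⟩ : ∃ δ > 0, ∀ z : E, ‖z - x₀‖ < δ →
      ‖g.coordMetric p z - g.coordMetric p x₀‖ < min m (c / (2 * (‖T₀‖ + 1))) :=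
    (NormedAddCommGroup.tendsto_nhds_nhds (f := g.coordMetric p) (x := x₀)
      (y := g.coordMetric p x₀)).1 hGc.tendsto _ hm₁
  obtain ⟨δ₃, hδ₃, hδ₃'⟩ : ∃ δ > 0, ∀ z : E, ‖z - x₀‖ < δ →
      ‖g.coordMetric p z (τ.coordTime p z) - g.coordMetric p x₀ T₀‖ < m :=
    (NormedAddCommGroup.tendsto_nhds_nhds (f := fun x ↦ g.coordMetric p x (τ.coordTime p x))
      (x := x₀) (y := g.coordMetric p x₀ T₀)).1 hGTc.tendsto _ hm
  -- radius `r₂`: Lipschitz continuity of `G`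
  obtain ⟨K, t, ht, hK⟩ := (hGcd.contDiffAt htarget).exists_lipschitzOnWith
  obtain ⟨r₂, hr₂, hr₂t⟩ := Metric.mem_nhds_iff.mp ht
  -- the scales `r`, `θ`, `ρ`
  set r : ℝ := min (min δ₁ δ₂) (min δ₃ r₂) with hrdef
  have hr0 : 0 < r := lt_min (lt_min hδ₁ hδ₂) (lt_min hδ₃ hr₂)
  have hrδ₁ : r ≤ δ₁ := (min_le_left _ _).trans (min_le_left _ _)
  have hrδ₂ : r ≤ δ₂ := (min_le_left _ _).trans (min_le_right _ _)
  have hrδ₃ : r ≤ δ₃ := (min_le_right _ _).trans (min_le_left _ _)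
  have hrr₂ : r ≤ r₂ := (min_le_right _ _).trans (min_le_right _ _)
  have hK0 : (0 : ℝ) ≤ K := K.coe_nonneg
  have hA0 : 0 < (1 / c + ‖T₀‖) ^ 2 := by positivity
  set θ : ℝ := min (r / 2) (1 / (2 * ((K : ℝ) + 1) * (1 / c + ‖T₀‖) ^ 2)) with hθdef
  have hθ0 : 0 < θ := lt_min (by positivity) (by positivity)
  have hθr : θ ≤ r / 2 := min_le_left _ _
  have hKθ : (K : ℝ) * θ * (1 / c + ‖T₀‖) ^ 2 ≤ 1 / 2 := by
    have h1 : θ ≤ 1 / (2 * ((K : ℝ) + 1) * (1 / c + ‖T₀‖) ^ 2) := min_le_right _ _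
    have h2 : (K : ℝ) / ((K : ℝ) + 1) ≤ 1 := by
      rw [div_le_one (by positivity)]; linarith
    calc (K : ℝ) * θ * (1 / c + ‖T₀‖) ^ 2
        ≤ (K : ℝ) * (1 / (2 * ((K : ℝ) + 1) * (1 / c + ‖T₀‖) ^ 2)) * (1 / c + ‖T₀‖) ^ 2 :=
          mul_le_mul_of_nonneg_right (mul_le_mul_of_nonneg_left h1 hK0) hA0.le
      _ = ((K : ℝ) / ((K : ℝ) + 1)) * (1 / 2) := by field_simp
      _ ≤ 1 * (1 / 2) := mul_le_mul_of_nonneg_right h2 (by norm_num)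
      _ = 1 / 2 := one_mul _
  set ρ : ℝ := min (r / 2) (θ / (2 * (‖ℓL‖ + 1) * (‖T₀‖ + 1))) with hρdef
  have hρ0 : 0 < ρ := lt_min (by positivity) (by positivity)
  have hρr : ρ ≤ r / 2 := min_le_left _ _
  have hρθ : ‖ℓL‖ * (2 * ρ) * ‖T₀‖ ≤ θ := by
    have h1 : ρ ≤ θ / (2 * (‖ℓL‖ + 1) * (‖T₀‖ + 1)) := min_le_right _ _
    have h2 : ρ * (2 * (‖ℓL‖ + 1) * (‖T₀‖ + 1)) ≤ θ := (le_div_iff₀ (by positivity)).mp h1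
    have e1 : 0 ≤ ρ * ‖ℓL‖ := mul_nonneg hρ0.le (norm_nonneg _)
    have e2 : 0 ≤ ρ * ‖T₀‖ := mul_nonneg hρ0.le (norm_nonneg _)
    have e3 : 0 ≤ ρ * ‖ℓL‖ * ‖T₀‖ := mul_nonneg e1 (norm_nonneg _)
    nlinarith [e1, e2, e3, hρ0.le, norm_nonneg ℓL, norm_nonneg T₀]
  -- the neighbourhood `N`
  set N : Set M := (extChartAt I p).source ∩ extChartAt I p ⁻¹' Metric.ball x₀ ρ with hNdef
  have hN : N ∈ 𝓝 p := Filter.inter_mem (extChartAt_source_mem_nhds p)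
    ((continuousAt_extChartAt p).preimage_mem_nhds
      (Metric.isOpen_ball.mem_nhds (Metric.mem_ball_self hρ0)))
  have hballr : Metric.ball x₀ r ⊆ (extChartAt I p).target := fun z hz ↦
    (hδ₁' z (lt_of_lt_of_le (by rw [← dist_eq_norm]; exact Metric.mem_ball.mp hz) hrδ₁)).1
  refine ⟨N, hN, fun γ a b hab hγ hγN V hV ↦ ?_⟩
  have hNs : ∀ s ∈ Icc a b, γ s ∈ (chartAt H p).source := fun s hs ↦ by
    rw [← extChartAt_source I p]; exact (hγN s hs).1
  have hNb : ∀ s ∈ Icc a b, ‖extChartAt I p (γ s) - x₀‖ < ρ := fun s hs ↦ by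
    have := (hγN s hs).2
    rwa [mem_preimage, Metric.mem_ball, dist_eq_norm] at this
  have ha : a ∈ Icc a b := left_mem_Icc.mpr hab.le
  have hb : b ∈ Icc a b := right_mem_Icc.mpr hab.le
  -- the curve and its velocity in coordinates
  set z : ℝ → E := fun s ↦ extChartAt I p (γ s) with hzdef
  set u : ℝ → E := fun s ↦ (trivializationAt E (TangentSpace I) p).continuousLinearMapAt ℝ
    (γ s) (velocity I γ s) with hudef
  have hcu : ∀ s ∈ Icc a b, HasDerivAt z (u s) s ∧
      (g.coordMetric p (z s) (u s) (u s) ≤ 0 ∧ u s ≠ 0) ∧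
      g.coordMetric p (z s) (τ.coordTime p (z s)) (u s) < 0 := by
    intro s hs
    obtain ⟨hmd, hfd⟩ := hγ s hs
    exact ⟨hasDerivAt_extChartAt_comp_continuousLinearMapAt (p := p) hmd (hNs s hs),
      (isFutureDirected_iff_coord (hNs s hs) _).mp hfd⟩
  -- the parameter `κ`: the tilted endpoint tends to `γ b` as `κ → 0`
  set Λ : ℝ := ℓL (z b - z a) with hΛdef
  set yκ : ℝ → M := fun κ ↦ (extChartAt I p).symm (z b + (κ * Λ) • T₀) with hyκdef
  have hzbt : z b ∈ (extChartAt I p).target := (extChartAt I p).map_source (hγN b hb).1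
  have hzbr : Metric.ball x₀ r ∈ 𝓝 (z b) := by
    refine Metric.isOpen_ball.mem_nhds (Metric.mem_ball.mpr ?_)
    rw [dist_eq_norm]
    linarith [hNb b hb]
  have hy0 : Tendsto yκ (𝓝[>] 0) (𝓝 (γ b)) := by
    have h1 : ContinuousAt (fun κ : ℝ ↦ z b + (κ * Λ) • T₀) 0 := by fun_prop
    have h2 : ContinuousAt (extChartAt I p).symm (z b + ((0 : ℝ) * Λ) • T₀) := by
      rw [zero_mul, zero_smul, add_zero]
      exact (continuousOn_extChartAt_symm p _ hzbt).continuousAt (mem_of_superset hzbr hballr)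
    have h3 : ContinuousAt yκ 0 :=
      (ContinuousAt.comp (f := fun κ : ℝ ↦ z b + (κ * Λ) • T₀) (x := (0 : ℝ)) h2 h1 :)
    have h4 : yκ 0 = γ b := by
      simp only [hyκdef, zero_mul, zero_smul, add_zero]
      exact (extChartAt I p).left_inv (hγN b hb).1
    rw [← h4]
    exact h3.tendsto.mono_left nhdsWithin_le_nhds
  obtain ⟨κ, hκV, hκ0, hκ1⟩ : ∃ κ, yκ κ ∈ V ∧ 0 < κ ∧ κ ≤ 1 := by
    have hev2 : ∀ᶠ κ in 𝓝[>] (0 : ℝ), yκ κ ∈ V ∧ κ ∈ Ioc (0 : ℝ) 1 :=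
      (hy0.eventually_mem hV).and (Ioc_mem_nhdsGT one_pos)
    obtain ⟨κ, h1, h2⟩ := hev2.exists
    exact ⟨κ, h1, h2.1, h2.2⟩
  -- the tilted curve
  set C : ℝ → E := fun s ↦ z s + (κ * ℓL (z s - z a)) • T₀ with hCdef
  set C' : ℝ → E := fun s ↦ u s + (κ * ℓL (u s)) • T₀ with hC'def
  have hCd : ∀ s ∈ Icc a b, HasDerivAt C (C' s) s := by
    intro s hs
    have hd := (hcu s hs).1
    have h2 : HasDerivAt (fun s ↦ ℓL (z s - z a)) (ℓL (u s)) s := by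
      have h3 : HasDerivAt (fun s ↦ z s - z a) (u s) s := hd.sub_const (z a)
      exact ℓL.hasFDerivAt.comp_hasDerivAt s h3
    exact hd.add ((h2.const_mul κ).smul_const T₀)
  -- the estimates along the tilted curve
  have hkey : ∀ s ∈ Icc a b, HasDerivAt C (C' s) s ∧ C s ∈ Metric.ball x₀ r ∧
      g.coordMetric p (C s) (C' s) (C' s) < 0 ∧
      g.coordMetric p (C s) (τ.coordTime p (C s)) (C' s) < 0 := by
    intro s hs
    obtain ⟨-, ⟨hvv, hv0⟩, hvf⟩ := hcu s hs
    have hzs : ‖z s - x₀‖ < ρ := hNb s hs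
    have hza : ‖z a - x₀‖ < ρ := hNb a ha
    -- the displacement
    have hlev : ‖C s - z s‖ ≤ θ * κ := by
      have h0 : C s - z s = (κ * ℓL (z s - z a)) • T₀ := by
        simp only [hCdef]; abel
      have hza' : ‖z s - z a‖ ≤ 2 * ρ := by
        calc ‖z s - z a‖ = ‖(z s - x₀) - (z a - x₀)‖ := by abel_nf
          _ ≤ ‖z s - x₀‖ + ‖z a - x₀‖ := norm_sub_le _ _
          _ ≤ 2 * ρ := by linarith
      have h1 : |ℓL (z s - z a)| ≤ ‖ℓL‖ * (2 * ρ) := by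
        calc |ℓL (z s - z a)| = ‖ℓL (z s - z a)‖ := (Real.norm_eq_abs _).symm
          _ ≤ ‖ℓL‖ * ‖z s - z a‖ := ℓL.le_opNorm _
          _ ≤ ‖ℓL‖ * (2 * ρ) := mul_le_mul_of_nonneg_left hza' (norm_nonneg _)
      rw [h0, norm_smul, Real.norm_eq_abs, abs_mul, abs_of_pos hκ0]
      calc κ * |ℓL (z s - z a)| * ‖T₀‖ ≤ κ * (‖ℓL‖ * (2 * ρ)) * ‖T₀‖ :=
            mul_le_mul_of_nonneg_right (mul_le_mul_of_nonneg_left h1 hκ0.le) (norm_nonneg _)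
        _ = κ * (‖ℓL‖ * (2 * ρ) * ‖T₀‖) := by ring
        _ ≤ κ * θ := mul_le_mul_of_nonneg_left hρθ hκ0.le
        _ = θ * κ := mul_comm _ _
    have hzsr : ‖z s - x₀‖ < r := by linarith
    have hCsr : ‖C s - x₀‖ < r := by
      calc ‖C s - x₀‖ = ‖(C s - z s) + (z s - x₀)‖ := by abel_nf
        _ ≤ ‖C s - z s‖ + ‖z s - x₀‖ := norm_add_le _ _
        _ < θ * κ + ρ := by linarith
        _ ≤ r / 2 * 1 + r / 2 := add_le_add (mul_le_mul hθr hκ1 hκ0.le (by linarith)) hρr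
        _ = r := by ring
    obtain ⟨hzt, hTTz, -⟩ := hδ₁' (z s) (lt_of_lt_of_le hzsr hrδ₁)
    obtain ⟨hCt, hTTC, hTcC⟩ := hδ₁' (C s) (lt_of_lt_of_le hCsr hrδ₁)
    have hGz := hδ₂' (z s) (lt_of_lt_of_le hzsr hrδ₂)
    have hGC := hδ₂' (C s) (lt_of_lt_of_le hCsr hrδ₂)
    have hGTz := hδ₃' (z s) (lt_of_lt_of_le hzsr hrδ₃)
    -- the number `ℓ`
    set ℓ : ℝ := ℓL (u s) with hℓdef
    have hℓ : c * ‖u s‖ ≤ ℓ := by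
      have := hcone (g.coordMetric p (z s)) (g.coordMetric p (z s) (τ.coordTime p (z s)))
        (lt_of_lt_of_le hGz (min_le_left _ _)) hGTz (u s) hvv hvf
      rw [hℓdef, hℓL]
      exact this
    have hℓ0 : 0 < ℓ := lt_of_lt_of_le (mul_pos hc (norm_pos_iff.mpr hv0)) hℓ
    -- `G_w(T₀, u s) ≤ -ℓ + (c/2) ‖u s‖` for `w` close to `x₀`
    have hbound : ∀ w : E,
        ‖g.coordMetric p w - g.coordMetric p x₀‖ < min m (c / (2 * (‖T₀‖ + 1))) →
        g.coordMetric p w T₀ (u s) ≤ -ℓ + c / 2 * ‖u s‖ := by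
      intro w hw
      have h1 : g.coordMetric p w T₀ (u s) - g.coordMetric p x₀ T₀ (u s) ≤
          ‖g.coordMetric p w - g.coordMetric p x₀‖ * ‖T₀‖ * ‖u s‖ :=
        PushUp.bilin_sub_le (g.coordMetric p x₀) (g.coordMetric p w) T₀ (u s)
      have h2 : g.coordMetric p x₀ T₀ (u s) = -ℓ := by rw [hℓdef, hℓL, neg_neg]
      have h4 : ‖g.coordMetric p w - g.coordMetric p x₀‖ ≤ c / (2 * (‖T₀‖ + 1)) :=
        (le_of_lt hw).trans (min_le_right _ _)
      have h5 : ‖g.coordMetric p w - g.coordMetric p x₀‖ * ‖T₀‖ ≤ c / 2 := by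
        calc ‖g.coordMetric p w - g.coordMetric p x₀‖ * ‖T₀‖
            ≤ c / (2 * (‖T₀‖ + 1)) * ‖T₀‖ := mul_le_mul_of_nonneg_right h4 (norm_nonneg _)
          _ ≤ c / (2 * (‖T₀‖ + 1)) * (‖T₀‖ + 1) :=
              mul_le_mul_of_nonneg_left (by linarith) (div_nonneg hc.le (by positivity))
          _ = c / 2 := by field_simp
      have h6 : ‖g.coordMetric p w - g.coordMetric p x₀‖ * ‖T₀‖ * ‖u s‖ ≤ c / 2 * ‖u s‖ :=
        mul_le_mul_of_nonneg_right h5 (norm_nonneg _)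
      linarith
    have hvT : g.coordMetric p (z s) (u s) T₀ ≤ -ℓ + c / 2 * ‖u s‖ := by
      rw [g.coordMetric_comm hzt (u s) T₀]
      exact hbound (z s) hGz
    have hvT' : g.coordMetric p (C s) T₀ (u s) ≤ -ℓ + c / 2 * ‖u s‖ := hbound (C s) hGC
    -- Lipschitz bound
    have hGG : ‖g.coordMetric p (C s) - g.coordMetric p (z s)‖ ≤ κ * (K * θ) := by
      have hCt₂ : C s ∈ t := hr₂t (Metric.mem_ball.mpr
        (by rw [dist_eq_norm]; exact lt_of_lt_of_le hCsr hrr₂))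
      have hzt₂ : z s ∈ t := hr₂t (Metric.mem_ball.mpr
        (by rw [dist_eq_norm]; exact lt_of_lt_of_le hzsr hrr₂))
      have h1 : ‖g.coordMetric p (C s) - g.coordMetric p (z s)‖ ≤ K * ‖C s - z s‖ := by
        have h := hK.dist_le_mul (C s) hCt₂ (z s) hzt₂
        rw [dist_eq_norm (C s) (z s)] at h
        exact le_of_eq_of_le (dist_eq_norm (g.coordMetric p (C s)) (g.coordMetric p (z s))).symm h
      calc ‖g.coordMetric p (C s) - g.coordMetric p (z s)‖ ≤ K * ‖C s - z s‖ := h1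
        _ ≤ K * (θ * κ) := mul_le_mul_of_nonneg_left hlev hK0
        _ = κ * (K * θ) := by ring
    -- the tilt estimates
    have hsym : g.coordMetric p (z s) T₀ (u s) = g.coordMetric p (z s) (u s) T₀ :=
      g.coordMetric_comm hzt _ _
    have hneg := PushUp.tilt_neg hκ0 hκ1 hc hℓ hℓ0 hsym hvv hvT hTTz.le hGG (by positivity) hKθ
    have horient := PushUp.tilt_orient hκ0 hℓ hℓ0 hvT' hTTC.le
    have hC's : C' s = u s + (κ * ℓ) • T₀ := rfl
    have hCC : g.coordMetric p (C s) (C' s) (C' s) < 0 := by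
      rw [hC's]
      have : -(κ * ℓ ^ 2) / 2 < 0 := by
        have := mul_pos hκ0 (pow_pos hℓ0 2); linarith
      exact lt_of_le_of_lt hneg this
    -- future-directedness at the new base point: same timecone as `T₀`
    have hfd : g.coordMetric p (C s) (τ.coordTime p (C s)) (C' s) < 0 := by
      have hT₀fd : τ.IsFutureDirected
          ((trivializationAt E (TangentSpace I) p).symmL ℝ ((extChartAt I p).symm (C s)) T₀) :=
        (isFutureDirected_symmL_iff hCt T₀).mpr ⟨⟨hTTC.le, hT₀0⟩, hTcC⟩
      have hT₀tl : g.IsTimelike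
          ((trivializationAt E (TangentSpace I) p).symmL ℝ ((extChartAt I p).symm (C s)) T₀) :=
        (isTimelike_symmL_iff hCt T₀).mpr hTTC
      have hV0 : C' s ≠ 0 := by
        intro h0
        have : g.coordMetric p (C s) (C' s) (C' s) = 0 := by rw [h0]; simp
        linarith
      have hVc : g.IsCausal
          ((trivializationAt E (TangentSpace I) p).symmL ℝ ((extChartAt I p).symm (C s)) (C' s)) :=
        (isCausal_symmL_iff hCt _).mpr ⟨hCC.le, hV0⟩
      have hval : g.val _
          ((trivializationAt E (TangentSpace I) p).symmL ℝ ((extChartAt I p).symm (C s)) T₀)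
          ((trivializationAt E (TangentSpace I) p).symmL ℝ ((extChartAt I p).symm (C s)) (C' s))
            < 0 :=
        lt_of_eq_of_lt (g.coordMetric_apply hCt T₀ (C' s)).symm horient
      have hVfd := (TimeOrientation.isFutureDirected_iff_val_neg τ hT₀fd hT₀tl hVc).mpr hval
      exact ((isFutureDirected_symmL_iff hCt (C' s)).mp hVfd).2
    exact ⟨hCd s hs, Metric.mem_ball.mpr (by rwa [dist_eq_norm]), hCC, hfd⟩
  -- the tilted curve is a future timelike curve from `γ a` to `yκ κ ∈ V`
  have hβ : g.IsFutureTimelikeCurveOn τ ((extChartAt I p).symm ∘ C) (Icc a b) :=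
    isFutureTimelikeCurveOn_extChartAt_symm_comp (U := Metric.ball x₀ r) Metric.isOpen_ball
      hballr fun s hs ↦ hkey s hs
  refine ⟨yκ κ, hκV, (extChartAt I p).symm ∘ C, hβ, ?_, ?_⟩
  · show (extChartAt I p).symm (C a) = γ a
    have : C a = z a := by simp only [hCdef, sub_self, map_zero, mul_zero, zero_smul, add_zero]
    rw [this]
    exact (extChartAt I p).left_inv (hγN a ha).1
  · rfl

/-! ### Part III: `J⁺ ⊆ closure I⁺` and push-up -/

/-- From `x ∈ I⁻(y)` to `y ∈ I⁺(x)`: read the witnessing timelike curve of the reversed time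
orientation backwards. O'Neill 1983, Ch. 14, p. 402 (time duality). [cite: ONeillSemiRiemannian1983, Ch. 14, p. 402] -/
theorem mem_chronologicalFuture_of_mem_chronologicalPast {x y : M}
    (h : x ∈ g.chronologicalPast τ {y}) : y ∈ g.chronologicalFuture τ {x} := by
  obtain ⟨y₀, hy₀, γ', a', b', hab', hγ', hγ'a, hγ'b⟩ := h
  rw [mem_singleton_iff] at hy₀
  subst hy₀
  refine ⟨x, rfl, fun s ↦ γ' (a' + b' - s), a', b', hab',
    isFutureTimelikeCurveOn_reverse_reverse_iff.mp hγ'.reverseParam, ?_, ?_⟩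
  · simp [hγ'b]
  · simp [hγ'a]

/-- From `y ∈ I⁺(x)` to `x ∈ I⁻(y)` (time duality). O'Neill 1983, Ch. 14, p. 402. [cite: ONeillSemiRiemannian1983, Ch. 14, p. 402] -/
theorem mem_chronologicalPast_of_mem_chronologicalFuture {x y : M}
    (h : y ∈ g.chronologicalFuture τ {x}) : x ∈ g.chronologicalPast τ {y} := by
  obtain ⟨x₀, hx₀, γ', a', b', hab', hγ', hγ'a, hγ'b⟩ := h
  rw [mem_singleton_iff] at hx₀
  subst hx₀
  refine ⟨y, rfl, fun s ↦ γ' (a' + b' - s), a', b', hab', hγ'.reverseParam, ?_, ?_⟩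
  · simp [hγ'b]
  · simp [hγ'a]

/-- **O'Neill's Lemma 14.6 (2) for points, along a causal curve**: on a finite-dimensional
manifold without boundary with a `Cⁿ` (`n ≥ 1`) time-oriented Lorentzian metric, if `γ` is a
future causal curve on `[a, b]` then `γ b ∈ closure (I⁺(γ a))`. Continuous induction on the
parameter: the set of `t` with `γ t ∈ closure I⁺(γ a)` is closed, contains `a`
(`mem_closure_chronologicalFuture_self`), and is open to the right by the local tilt lemma
(`exists_nhds_tilt`) combined with the openness of `I⁻` and transitivity of `≪`.
O'Neill 1983, Ch. 14, Lemma 14.6 (2) (p. 404: "`J⁺(A) ⊂ cl I⁺(A)`"). [cite: ONeillSemiRiemannian1983, Ch. 14, Lemma 14.6 (2) (p. 404)] -/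
theorem mem_closure_chronologicalFuture_of_isFutureCausalCurveOn [BoundarylessManifold I M]
    [FiniteDimensional ℝ E] (hn : 1 ≤ n) {γ : ℝ → M} {a b : ℝ} (hab : a ≤ b)
    (hγ : g.IsFutureCausalCurveOn τ γ (Icc a b)) :
    γ b ∈ closure (g.chronologicalFuture τ {γ a}) := by
  set s : Set ℝ := {t | γ t ∈ closure (g.chronologicalFuture τ {γ a})} with hsdef
  suffices h : Icc a b ⊆ s from h (right_mem_Icc.mpr hab)
  have hcont : ContinuousOn γ (Icc a b) := fun t ht ↦ (hγ t ht).1.continuousAt.continuousWithinAt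
  refine IsClosed.Icc_subset_of_forall_mem_nhdsWithin ?_ ?_ ?_
  · have := hcont.preimage_isClosed_of_isClosed isClosed_Icc
      (isClosed_closure (s := g.chronologicalFuture τ {γ a}))
    rwa [inter_comm] at this
  · exact g.mem_closure_chronologicalFuture_self τ BoundarylessManifold.isInteriorPoint
  · rintro t ⟨ht, hta, htb⟩
    obtain ⟨N, hN, htilt⟩ := exists_nhds_tilt (g := g) (τ := τ) hn (γ t)
    have hct : ContinuousAt γ t := (hγ t ⟨hta, htb.le⟩).1.continuousAt
    obtain ⟨δ, hδ, hδN⟩ : ∃ δ > 0, ∀ t', dist t' t < δ → γ t' ∈ N := by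
      have := hct.preimage_mem_nhds hN
      rw [Metric.mem_nhds_iff] at this
      obtain ⟨δ, hδ, h⟩ := this
      exact ⟨δ, hδ, fun t' ht' ↦ h ht'⟩
    have hm : t < min (t + δ) b := lt_min (by linarith) htb
    filter_upwards [Ioo_mem_nhdsGT hm] with t'' ht''
    have ht''b : t'' ≤ b := (ht''.2.trans_le (min_le_right _ _)).le
    have ht''δ : t'' < t + δ := ht''.2.trans_le (min_le_left _ _)
    have hsub : Icc t t'' ⊆ Icc a b := Icc_subset_Icc hta ht''b
    have harcN : ∀ s' ∈ Icc t t'', γ s' ∈ N := fun s' hs' ↦ hδN s' (by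
      rw [Real.dist_eq, abs_lt]; constructor <;> linarith [hs'.1, hs'.2])
    show γ t'' ∈ closure (g.chronologicalFuture τ {γ a})
    rw [mem_closure_iff_nhds]
    intro V hV
    obtain ⟨y, hyV, β, hβ, hβa, hβb⟩ := htilt γ t t'' ht''.1 (hγ.mono hsub) harcN V hV
    -- `γ t ∈ I⁻(y)`, an open set, meets `I⁺(γ a)`
    have hqy : γ t ∈ g.chronologicalPast τ {y} := by
      refine ⟨y, rfl, fun s' ↦ β (t + t'' - s'), t, t'', ht''.1, hβ.reverseParam, ?_, ?_⟩
      · simp [hβb]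
      · simp [hβa]
    obtain ⟨y', hy'P, hy'F⟩ := mem_closure_iff_nhds.mp ht _
      ((isOpen_chronologicalPast_of_boundaryless g τ {y}).mem_nhds hqy)
    exact ⟨y, hyV, mem_chronologicalFuture_trans hy'F
      (mem_chronologicalFuture_of_mem_chronologicalPast hy'P)⟩

/-- **O'Neill's Lemma 14.6 (2) on a manifold without boundary**: `J⁺(S) ⊆ closure (I⁺(S))`
for every `S ⊆ M` (finite dimension, `Cⁿ` metric with `n ≥ 1`). O'Neill 1983, Ch. 14,
Lemma 14.6 (2) (p. 404); Hawking–Ellis 1973, §6.2. [cite: ONeillSemiRiemannian1983, Ch. 14, Lemma 14.6 (2) (p. 404)] -/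
theorem causalFuture_subset_closure_chronologicalFuture_of_boundaryless [BoundarylessManifold I M]
    [FiniteDimensional ℝ E] (hn : 1 ≤ n) (S : Set M) :
    g.causalFuture τ S ⊆ closure (g.chronologicalFuture τ S) := by
  rintro q (hq | ⟨p, hp, γ, a, b, hab, hγ, hγa, hγb⟩)
  · exact subset_closure_chronologicalFuture (g := g) (τ := τ) S hq
  · have h := mem_closure_chronologicalFuture_of_isFutureCausalCurveOn hn hab.le hγ
    rw [hγa, hγb] at h
    exact closure_mono (chronologicalFuture_mono (singleton_subset_iff.mpr hp)) h

/-- Restricted discharge of the parametrised predicate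
`causalFuture_subset_closure_chronologicalFuture` on manifolds without boundary (finite
dimension): `∀ (2 ≤ n) S, J⁺(S) ⊆ closure (I⁺(S))`. The unrestricted predicate is refuted with
boundary (`Literature.Geometry.Lorentzian.CausalityClosure`). O'Neill 1983, Ch. 14, Lemma 14.6 (2).
[cite: ONeillSemiRiemannian1983, Ch. 14, Lemma 14.6 (2) (p. 404)] -/
theorem causalFuture_subset_closure_chronologicalFuture_holds_of_boundaryless
    [BoundarylessManifold I M] [FiniteDimensional ℝ E] :
    g.causalFuture_subset_closure_chronologicalFuture τ := fun hn S ↦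
  causalFuture_subset_closure_chronologicalFuture_of_boundaryless (le_trans one_le_two hn) S

/-- **Push-up (O'Neill's Corollary 14.1)**: on a finite-dimensional manifold without boundary with
a `Cⁿ` (`n ≥ 1`) time-oriented Lorentzian metric, `q ∈ J⁺(p)` and `r ∈ I⁺(q)` imply `r ∈ I⁺(p)`
("if `x ≤ y` and `y ≪ z` then `x ≪ z`"). Proof: `q ∈ closure I⁺(p)`
(`mem_closure_chronologicalFuture_of_isFutureCausalCurveOn`) and `q ∈ I⁻(r)`, which is open, so
some `y' ∈ I⁺(p)` has `y' ≪ r`, and `≪` is transitive. O'Neill 1983, Ch. 14, Cor. 14.1 (p. 402).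
[cite: ONeillSemiRiemannian1983, Ch. 14, Cor. 14.1 (p. 402)] -/
theorem mem_chronologicalFuture_of_mem_causalFuture [BoundarylessManifold I M]
    [FiniteDimensional ℝ E] (hn : 1 ≤ n) {p q r : M} (hq : q ∈ g.causalFuture τ {p})
    (hr : r ∈ g.chronologicalFuture τ {q}) : r ∈ g.chronologicalFuture τ {p} := by
  rcases hq with hq | ⟨p', hp', γ, a, b, hab, hγ, hγa, hγb⟩
  · rw [mem_singleton_iff] at hq
    subst hq
    exact hr
  · rw [mem_singleton_iff] at hp'
    subst hp'
    have hcl : q ∈ closure (g.chronologicalFuture τ {γ a}) := by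
      rw [← hγb]
      exact mem_closure_chronologicalFuture_of_isFutureCausalCurveOn hn hab.le hγ
    rw [hγa] at hcl
    have hqr : q ∈ g.chronologicalPast τ {r} := mem_chronologicalPast_of_mem_chronologicalFuture hr
    obtain ⟨y', hy'P, hy'F⟩ := mem_closure_iff_nhds.mp hcl _
      ((isOpen_chronologicalPast_of_boundaryless g τ {r}).mem_nhds hqr)
    exact mem_chronologicalFuture_trans hy'F (mem_chronologicalFuture_of_mem_chronologicalPast hy'P)

/-- **`I⁺(J⁺(S)) = I⁺(S)`** on a finite-dimensional manifold without boundary with a `Cⁿ`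
(`n ≥ 1`) time-oriented Lorentzian metric. O'Neill 1983, Ch. 14, p. 403
("`I⁺(A) = I⁺(I⁺A) = I⁺(J⁺A)`"), from Cor. 14.1. [cite: ONeillSemiRiemannian1983, Ch. 14, Cor. 14.1 and p. 403] -/
theorem chronologicalFuture_causalFuture_eq_of_boundaryless [BoundarylessManifold I M]
    [FiniteDimensional ℝ E] (hn : 1 ≤ n) (S : Set M) :
    g.chronologicalFuture τ (g.causalFuture τ S) = g.chronologicalFuture τ S := by
  refine Subset.antisymm ?_ (chronologicalFuture_mono (subset_causalFuture g τ S))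
  intro r hr
  rw [chronologicalFuture_eq_biUnion] at hr
  simp only [mem_iUnion, exists_prop] at hr
  obtain ⟨q, hq, hrq⟩ := hr
  rw [causalFuture_eq_biUnion] at hq
  simp only [mem_iUnion, exists_prop] at hq
  obtain ⟨p, hp, hqp⟩ := hq
  rw [chronologicalFuture_eq_biUnion]
  simp only [mem_iUnion, exists_prop]
  exact ⟨p, hp, mem_chronologicalFuture_of_mem_causalFuture hn hqp hrq⟩

/-- **Restricted discharge of the push-up predicate `chronologicalFuture_causalFuture`** on
manifolds without boundary (finite dimension): `∀ (2 ≤ n) S, I⁺(J⁺(S)) = I⁺(S)`. A consumer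
`(h : g.chronologicalFuture_causalFuture τ)` on a boundaryless manifold is fed this term; the
unrestricted predicate is false with boundary
(`HalfPlane.not_chronologicalFuture_causalFuture`, `Literature.Geometry.Lorentzian.CausalityBoundary`).
O'Neill 1983, Ch. 14, Cor. 14.1 (p. 402) and p. 403. [cite: ONeillSemiRiemannian1983, Ch. 14, Cor. 14.1 (p. 402)] -/
theorem chronologicalFuture_causalFuture_holds_of_boundaryless [BoundarylessManifold I M]
    [FiniteDimensional ℝ E] : g.chronologicalFuture_causalFuture τ := fun hn S ↦
  chronologicalFuture_causalFuture_eq_of_boundaryless (le_trans one_le_two hn) S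

/-- **O'Neill's Lemma 14.6 (2), unconditionally, on manifolds without boundary** (finite
dimension, `2 ≤ n`): the conditional theorem
`causalFuture_subset_closure_chronologicalFuture_of_chronologicalFuture_causalFuture` of
`Literature.Geometry.Lorentzian.CausalityClosure` fed with push-up. O'Neill 1983, Ch. 14,
Lemma 14.6 (2) (p. 404). [cite: ONeillSemiRiemannian1983, Ch. 14, Lemma 14.6 (2) (p. 404)] -/
theorem causalFuture_subset_closure_chronologicalFuture_of_pushUp [BoundarylessManifold I M]
    [FiniteDimensional ℝ E] (hn : 2 ≤ n) (S : Set M) :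
    g.causalFuture τ S ⊆ closure (g.chronologicalFuture τ S) :=
  causalFuture_subset_closure_chronologicalFuture_of_chronologicalFuture_causalFuture (g := g)
    (τ := τ) (h := chronologicalFuture_causalFuture_holds_of_boundaryless) (hn := hn) (S := S)

end LorentzianMetric

end Literature.Geometry.Lorentzian

end
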